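import Summits.QuantumFields.BalabanUV.Beta.GAN24.Push4FrozenLayers

/-!
# `BalabanUV.Beta.GAN24.Push4Frozen` — binder row G-an2-4 / (CONV-C), W-slot road «W3», ROW W3-F3b (T-irr) (gan24-p1-g5 `SKELETON-W3.md` v1.0.2
# §8.6 (F3-core-b); journal INTENT «W3-TIRR*» l.7944), core part 4b (part 4a = `GAN24/Push4FrozenLayers`): FREEZING THE THREE INNER LEGS OF THE SLICE PUSH AT THE FIRST TABLE BOND —
# `push₃ l r (X κ u) ν y′ x′ z′ (inl α) (inl β) = Σ_{κ₂ κ₁ κ′} r β z′ κ₂ u · l α x′ κ₁ u · r ν y′ κ′ u · sliceSum X κ u κ′ κ₁ κ₂ + REMAINDER`,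
# `|REMAINDER| ≤ (d+1)³ · C · M₁ · Σ (one q, two p, two Zl)` — ONE TAYLOR ORDER, the first-moment half of (T-irr)

NOT IN PRINT; OUR PROOF ATTEMPT ([folklore] real analysis over leaf-17's `Push4` carrier; 0 cited facts, 0 `def`, 0 `def … : Prop`, 0 wall binders).  HONEST
FRAMING (cell contract, verbatim): «discharging `BetaPertH` makes Bałaban's UV stability UNCONDITIONAL — a real constructive-QFT result; it is NOT the
continuum limit and NOT the Clay problem.»  HONEST DEPENDENCY (verbatim): «continuum YM on T⁴ ⇐ BetaPertH ∧ nine spine estimates (0/9 proved); BetaPertH ⇐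
(D1) ∧ (D4) ∧ CAP+tail; G-an2-4 gates asym, D1 and NE2/3/4.»  Discharges NOTHING of «T2Shape» ∕ «T2SupRate» ∕ (hW₂, hW₂all); NOT «W-slot closed», NEVER
«G-an2-4 closed»; NOT `BetaPertH`, NOT continuum, NOT Clay.

## Setting (one slice `X κ u` of a `LocStencil₂ X C δ` table; the output data `ν y′ x′ z′ α β` fixed)
The three inner legs of `Push4Slices.push₃` — the second table leg `v ↦ r ν y′ κ′ v`, the left kernel leg `x ↦ l α x′ κ₁ x`, the right kernel leg
`z ↦ r β z′ κ₂ z` — are given with a SUP allowance and a LIPSCHITZ allowance RELATIVE TO THE BASE POINT `u` (the shape `LatticeFreeze` consumes; the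
(N1)∕(N1′)-type envelopes of `RespStepDecay` produce it by `EnvelopeBlockSum.env_wobble` + `LatticeFreeze.abs_sub_le_of_unit_steps`, in part 5):
`|leg v| ≤ p·e^{κ₀|v−u|₁}`, `|leg v − leg u| ≤ q·|v−u|₁·e^{κ₀|v−u|₁}`, `0 ≤ κ₀ < δ`.

## What is proved (generic `d`)
* §2 (continued from part 4a `GAN24/Push4FrozenLayers`, which has the layers and `stepC`) THE SECOND AND THIRD FREEZING STEPS `T₁ = T₂ + R_B` (**`stepB`**,
  the left kernel leg), `T₂ = T₃ + R_A` (**`stepA`**, the second table leg), each remainder `≤ (d+1)³·C·M₁·(one q, two p)·(two Zl)`,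
  `M₁ := (2/(δ−κ₀))·Zl((δ−κ₀)/2)` (`LatticeFreeze.abs_tsum_mul_sub_frozen_le` at each layer).
* §3 `frozen_eq_sum_sliceSum` (`T₃ = Σ_{κ₂} Σ_{κ₁} Σ_{κ′} r β z′ κ₂ u · (l α x′ κ₁ u · (r ν y′ κ′ u · sliceSum X κ u κ′ κ₁ κ₂))`, via
  `Push4Slices.tsum_zxu_eq_sliceSum`) and §4 the packaged statement **`abs_push₃_sub_frozen_le`**.
Unit `b2b-balaban-gan24-formalise-leaf-12` (G-an2-4 formalisation swarm, leaf prover 12, gen 20; ROW W3-F3b holder), 2026-08-20.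
-/

noncomputable section

open Finset
open scoped BigOperators
open Literature.MathematicalPhysics.QuantumFieldTheory
open Literature.MathematicalPhysics.QuantumFieldTheory.Balaban1983to89
open Literature.MathematicalPhysics.QuantumFieldTheory.Balaban1983to89.Beta
open B12Sec2to5 (l1 l1_nonneg)
open ExpKernelCalculus (MKer comp Zl Zl_nonneg Zl_pos summable_exp_shift summable_exp_shift' tsum_exp_shift tsum_exp_shift' l1_sub_triangle l1_sub_symm)
open OneStepResolventKernel (Fib)
open BalabanCompositeJets (LocStencil₂ LocStencil₂.nonneg)
open Summit.QuantumFields.BalabanUV.Beta.GAN24.Push4 (vertexW vertexW_apply)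
open Summit.QuantumFields.BalabanUV.Beta.GAN24.Push4Slices (push₃ push₃_inl_inl sliceSum tsum_zxu_eq_sliceSum)
open Summit.QuantumFields.BalabanUV.Beta.GAN24.BiStencilZeroMode (Tab)
open Summit.QuantumFields.BalabanUV.Beta.GAN24.LatticeFreeze (summable_mul_of_env abs_tsum_mul_le_of_env abs_tsum_mul_sub_frozen_le)

open Summit.QuantumFields.BalabanUV.Beta.GAN24.Push4FrozenLayers (summable_of_abs_le_exp abs_tsum_le_of_abs_le_exp abs_sub_le_of_three abs_base_le
  abs_slice_le abs_tsum_slice_le abs_inner_le abs_W_le abs_xlayer_le abs_G_le stepC)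


namespace Summit.QuantumFields.BalabanUV.Beta.GAN24.Push4Frozen

variable {d : ℕ}

section Slice

/-! Fixed data: the legs, the table, the slice `(κ, u)`, the output indices, the constants. -/
variable {l r : Fin (d + 1) → (Fin (d + 1) → ℤ) → Fin (d + 1) → (Fin (d + 1) → ℤ) → ℝ} {X : Tab d} {C δ κ₀ p₁ q₁ p₂ q₂ p₃ q₃ : ℝ}
  {κ : Fin (d + 1)} {u : Fin (d + 1) → ℤ} {ν : Fin (d + 1)} {y' : Fin (d + 1) → ℤ} {α : Fin (d + 1)} {x' : Fin (d + 1) → ℤ}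
  {β : Fin (d + 1)} {z' : Fin (d + 1) → ℤ}
  (hX : LocStencil₂ X C δ) (hδ : 0 < δ) (hκ0 : 0 ≤ κ₀) (hκδ : κ₀ < δ)
  (hp₁ : 0 ≤ p₁) (hq₁ : 0 ≤ q₁) (hp₂ : 0 ≤ p₂) (hq₂ : 0 ≤ q₂) (hp₃ : 0 ≤ p₃) (hq₃ : 0 ≤ q₃)
  (hr₁ : ∀ κ' v, |r ν y' κ' v| ≤ p₁ * Real.exp (κ₀ * l1 (v - u)))
  (hr₁' : ∀ κ' v, |r ν y' κ' v - r ν y' κ' u| ≤ q₁ * l1 (v - u) * Real.exp (κ₀ * l1 (v - u)))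
  (hl₁ : ∀ κ₁ x, |l α x' κ₁ x| ≤ p₂ * Real.exp (κ₀ * l1 (x - u)))
  (hl₁' : ∀ κ₁ x, |l α x' κ₁ x - l α x' κ₁ u| ≤ q₂ * l1 (x - u) * Real.exp (κ₀ * l1 (x - u)))
  (hr₂ : ∀ κ₂ z, |r β z' κ₂ z| ≤ p₃ * Real.exp (κ₀ * l1 (z - u)))
  (hr₂' : ∀ κ₂ z, |r β z' κ₂ z - r β z' κ₂ u| ≤ q₃ * l1 (z - u) * Real.exp (κ₀ * l1 (z - u)))

/-! ## §2 (continued) The second and third freezing steps -/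

section Steps

include hX hδ hκ0 hκδ hp₁ hp₂ hq₂ hp₃ hr₁ hl₁ hl₁' hr₂ in
/-- [folklore] **STEP B — FREEZE THE LEFT KERNEL LEG** (layer `x`, inside the frozen right leg):
`|Σ_{κ₂} r₂(u)·Σ'_z G z κ₂ − Σ_{κ₂} r₂(u)·Σ'_z Σ_{κ₁} l₁(u)·Σ'_x W x z κ₁ κ₂| ≤ (d+1)³·p₃·q₂·p₁·C·Zl₁·Zl δ·M₁`. -/
theorem stepB :
    |∑ κ₂, r β z' κ₂ u * ∑' z : Fin (d + 1) → ℤ, ∑' x : Fin (d + 1) → ℤ, ∑ κ₁,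
            l α x' κ₁ x * vertexW r (X κ u) ν y' x z (Sum.inl κ₁) (Sum.inl κ₂)
        - ∑ κ₂, r β z' κ₂ u * ∑' z : Fin (d + 1) → ℤ, ∑ κ₁, l α x' κ₁ u *
            ∑' x : Fin (d + 1) → ℤ, vertexW r (X κ u) ν y' x z (Sum.inl κ₁) (Sum.inl κ₂)|
      ≤ (d + 1 : ℕ) * (p₃ * (((d + 1 : ℕ) * (q₂ * 1 * ((d + 1 : ℕ) * p₁ * C * Zl (d + 1) (δ - κ₀)) *
          (2 / (δ - κ₀) * Zl (d + 1) ((δ - κ₀) / 2)))) * Zl (d + 1) δ)) := by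
  -- notation: `W x z κ₁ κ₂`
  set W : (Fin (d + 1) → ℤ) → (Fin (d + 1) → ℤ) → Fin (d + 1) → Fin (d + 1) → ℝ := fun x z κ₁ κ₂ =>
    vertexW r (X κ u) ν y' x z (Sum.inl κ₁) (Sum.inl κ₂) with hW
  have hWb : ∀ z κ₁ κ₂ x, |W x z κ₁ κ₂| ≤ ((d + 1 : ℕ) * p₁ * C * Zl (d + 1) (δ - κ₀) * Real.exp (-δ * l1 (z - u))) *
      Real.exp (-δ * l1 (x - u)) := fun z κ₁ κ₂ x => abs_W_le hX hκδ hp₁ hr₁ x z κ₁ κ₂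
  have hw : ∀ κ₁ v, |l α x' κ₁ v| ≤ p₂ * Real.exp (κ₀ * l1 (v - u)) * 1 := fun κ₁ v => by rw [mul_one]; exact hl₁ κ₁ v
  have hw' : ∀ κ₁ v, |l α x' κ₁ v - l α x' κ₁ u| ≤ q₂ * l1 (v - u) * Real.exp (κ₀ * l1 (v - u)) * 1 := fun κ₁ v => by
    rw [mul_one]; exact hl₁' κ₁ v
  have hsx : ∀ z κ₁ κ₂, Summable fun x => l α x' κ₁ x * W x z κ₁ κ₂ := fun z κ₁ κ₂ =>
    summable_mul_of_env hκδ hp₂ zero_le_one (hw κ₁) (hWb z κ₁ κ₂)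
  have hremx : ∀ z κ₁ κ₂, |∑' x, l α x' κ₁ x * W x z κ₁ κ₂ - l α x' κ₁ u * ∑' x, W x z κ₁ κ₂|
      ≤ q₂ * 1 * ((d + 1 : ℕ) * p₁ * C * Zl (d + 1) (δ - κ₀) * Real.exp (-δ * l1 (z - u))) *
          (2 / (δ - κ₀) * Zl (d + 1) ((δ - κ₀) / 2)) := fun z κ₁ κ₂ =>
    abs_tsum_mul_sub_frozen_le hκδ hκ0 hq₂ zero_le_one (hw' κ₁) (hWb z κ₁ κ₂) (hsx z κ₁ κ₂)
  -- per (z, κ₂): the κ₁-sum of remainders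
  set R : (Fin (d + 1) → ℤ) → Fin (d + 1) → ℝ := fun z κ₂ =>
    ∑ κ₁, (∑' x, l α x' κ₁ x * W x z κ₁ κ₂ - l α x' κ₁ u * ∑' x, W x z κ₁ κ₂) with hR
  have hRb : ∀ κ₂ z, |R z κ₂| ≤ ((d + 1 : ℕ) * (q₂ * 1 * ((d + 1 : ℕ) * p₁ * C * Zl (d + 1) (δ - κ₀)) *
      (2 / (δ - κ₀) * Zl (d + 1) ((δ - κ₀) / 2)))) * Real.exp (-δ * l1 (z - u)) := by
    intro κ₂ z
    calc |R z κ₂| ≤ ∑ κ₁, |∑' x, l α x' κ₁ x * W x z κ₁ κ₂ - l α x' κ₁ u * ∑' x, W x z κ₁ κ₂| := Finset.abs_sum_le_sum_abs _ _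
      _ ≤ ∑ _κ₁ : Fin (d + 1), q₂ * 1 * ((d + 1 : ℕ) * p₁ * C * Zl (d + 1) (δ - κ₀) * Real.exp (-δ * l1 (z - u))) *
          (2 / (δ - κ₀) * Zl (d + 1) ((δ - κ₀) / 2)) := Finset.sum_le_sum fun κ₁ _ => hremx z κ₁ κ₂
      _ = _ := by rw [Finset.sum_const, Finset.card_univ, Fintype.card_fin, nsmul_eq_mul]; ring
  -- the difference of the two `z`-integrands is `R z κ₂`
  have hGswap : ∀ z κ₂, (∑' x, ∑ κ₁, l α x' κ₁ x * W x z κ₁ κ₂) = ∑ κ₁, ∑' x, l α x' κ₁ x * W x z κ₁ κ₂ :=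
    fun z κ₂ => (abs_G_le hX hκδ hp₁ hp₂ hr₁ hl₁ z κ₂).2.1
  have hGs : ∀ κ₂, Summable fun z => ∑' x, ∑ κ₁, l α x' κ₁ x * W x z κ₁ κ₂ := fun κ₂ =>
    summable_of_abs_le_exp hδ u (fun z => (abs_G_le hX hκδ hp₁ hp₂ hr₁ hl₁ z κ₂).2.2)
  have hFb : ∀ κ₂ z, |∑ κ₁, l α x' κ₁ u * ∑' x, W x z κ₁ κ₂| ≤ ((d + 1 : ℕ) * (p₂ * ((d + 1 : ℕ) * p₁ * C * Zl (d + 1) (δ - κ₀) *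
      Zl (d + 1) δ))) * Real.exp (-δ * l1 (z - u)) := by
    intro κ₂ z
    calc |∑ κ₁, l α x' κ₁ u * ∑' x, W x z κ₁ κ₂| ≤ ∑ κ₁, |l α x' κ₁ u * ∑' x, W x z κ₁ κ₂| := Finset.abs_sum_le_sum_abs _ _
      _ ≤ ∑ _κ₁ : Fin (d + 1), p₂ * (((d + 1 : ℕ) * p₁ * C * Zl (d + 1) (δ - κ₀) * Real.exp (-δ * l1 (z - u))) * Zl (d + 1) δ) :=
          Finset.sum_le_sum fun κ₁ _ => by
            rw [abs_mul]
            exact mul_le_mul (abs_base_le (hl₁ κ₁)) (abs_tsum_le_of_abs_le_exp hδ u (hWb z κ₁ κ₂)) (abs_nonneg _) hp₂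
      _ = _ := by rw [Finset.sum_const, Finset.card_univ, Fintype.card_fin, nsmul_eq_mul]; ring
  have hFs : ∀ κ₂, Summable fun z => ∑ κ₁, l α x' κ₁ u * ∑' x, W x z κ₁ κ₂ := fun κ₂ =>
    summable_of_abs_le_exp hδ u (hFb κ₂)
  have hdiff : ∀ κ₂, (∑' z, ∑' x, ∑ κ₁, l α x' κ₁ x * W x z κ₁ κ₂) - (∑' z, ∑ κ₁, l α x' κ₁ u * ∑' x, W x z κ₁ κ₂)
      = ∑' z, R z κ₂ := by
    intro κ₂
    rw [← (hGs κ₂).tsum_sub (hFs κ₂)]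
    refine tsum_congr fun z => ?_
    rw [hGswap z κ₂, hR, ← Finset.sum_sub_distrib]
  rw [← Finset.sum_sub_distrib]
  calc |∑ κ₂, (r β z' κ₂ u * ∑' z, ∑' x, ∑ κ₁, l α x' κ₁ x * W x z κ₁ κ₂
          - r β z' κ₂ u * ∑' z, ∑ κ₁, l α x' κ₁ u * ∑' x, W x z κ₁ κ₂)|
      ≤ ∑ κ₂, |r β z' κ₂ u * ∑' z, ∑' x, ∑ κ₁, l α x' κ₁ x * W x z κ₁ κ₂
          - r β z' κ₂ u * ∑' z, ∑ κ₁, l α x' κ₁ u * ∑' x, W x z κ₁ κ₂| := Finset.abs_sum_le_sum_abs _ _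
    _ ≤ ∑ _κ₂ : Fin (d + 1), p₃ * (((d + 1 : ℕ) * (q₂ * 1 * ((d + 1 : ℕ) * p₁ * C * Zl (d + 1) (δ - κ₀)) *
          (2 / (δ - κ₀) * Zl (d + 1) ((δ - κ₀) / 2)))) * Zl (d + 1) δ) := Finset.sum_le_sum fun κ₂ _ => by
        rw [← mul_sub, abs_mul, hdiff κ₂]
        exact mul_le_mul (abs_base_le (hr₂ κ₂)) (abs_tsum_le_of_abs_le_exp hδ u (hRb κ₂)) (abs_nonneg _) hp₃
    _ = _ := by rw [Finset.sum_const, Finset.card_univ, Fintype.card_fin, nsmul_eq_mul]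

include hX hδ hκ0 hκδ hp₁ hq₁ hp₂ hp₃ hr₁ hr₁' hl₁ hr₂ in
/-- [folklore] **STEP A — FREEZE THE SECOND TABLE LEG** (innermost layer `u′`, inside the two frozen kernel legs):
`|Σ_{κ₂} r₂(u)·Σ'_z Σ_{κ₁} l₁(u)·Σ'_x W − Σ_{κ₂} r₂(u)·Σ'_z Σ_{κ₁} l₁(u)·Σ'_x Σ_{κ′} r₁(u)·Σ'_{u′} X…| ≤ (d+1)³·p₃·p₂·q₁·C·M₁·(Zl δ)²`. -/
theorem stepA :
    |∑ κ₂, r β z' κ₂ u * ∑' z : Fin (d + 1) → ℤ, ∑ κ₁, l α x' κ₁ u *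
            ∑' x : Fin (d + 1) → ℤ, vertexW r (X κ u) ν y' x z (Sum.inl κ₁) (Sum.inl κ₂)
        - ∑ κ₂, r β z' κ₂ u * ∑' z : Fin (d + 1) → ℤ, ∑ κ₁, l α x' κ₁ u *
            ∑' x : Fin (d + 1) → ℤ, ∑ κ', r ν y' κ' u * ∑' u' : Fin (d + 1) → ℤ, X κ u κ' u' x z (Sum.inl κ₁) (Sum.inl κ₂)|
      ≤ (d + 1 : ℕ) * (p₃ * (((d + 1 : ℕ) * (p₂ * (((d + 1 : ℕ) * (q₁ * 1 * C * (2 / (δ - κ₀) * Zl (d + 1) ((δ - κ₀) / 2))))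
          * Zl (d + 1) δ))) * Zl (d + 1) δ)) := by
  -- per (x, z, κ₁, κ₂, κ'): the u'-freezing remainder
  have hw' : ∀ κ' v, |r ν y' κ' v - r ν y' κ' u| ≤ q₁ * l1 (v - u) * Real.exp (κ₀ * l1 (v - u)) * 1 := fun κ' v => by
    rw [mul_one]; exact hr₁' κ' v
  have hrem : ∀ κ' x z κ₁ κ₂, |∑' u', r ν y' κ' u' * X κ u κ' u' x z (Sum.inl κ₁) (Sum.inl κ₂)
      - r ν y' κ' u * ∑' u', X κ u κ' u' x z (Sum.inl κ₁) (Sum.inl κ₂)|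
      ≤ q₁ * 1 * (C * Real.exp (-δ * (l1 (x - u) + l1 (z - u)))) * (2 / (δ - κ₀) * Zl (d + 1) ((δ - κ₀) / 2)) :=
    fun κ' x z κ₁ κ₂ => abs_tsum_mul_sub_frozen_le hκδ hκ0 hq₁ zero_le_one (hw' κ') (abs_slice_le hX κ' x z κ₁ κ₂)
      (abs_inner_le hX hκδ hp₁ hr₁ κ' x z κ₁ κ₂).1
  -- `W − W^frozen` per (x,z,κ₁,κ₂)
  set D₁ : (Fin (d + 1) → ℤ) → (Fin (d + 1) → ℤ) → Fin (d + 1) → Fin (d + 1) → ℝ := fun x z κ₁ κ₂ =>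
    vertexW r (X κ u) ν y' x z (Sum.inl κ₁) (Sum.inl κ₂)
      - ∑ κ', r ν y' κ' u * ∑' u', X κ u κ' u' x z (Sum.inl κ₁) (Sum.inl κ₂) with hD₁
  have hD₁b : ∀ z κ₁ κ₂ x, |D₁ x z κ₁ κ₂| ≤ ((d + 1 : ℕ) * (q₁ * 1 * C * (2 / (δ - κ₀) * Zl (d + 1) ((δ - κ₀) / 2))) *
      Real.exp (-δ * l1 (z - u))) * Real.exp (-δ * l1 (x - u)) := by
    intro z κ₁ κ₂ x
    rw [hD₁]; dsimp only
    rw [vertexW_apply, ← Finset.sum_sub_distrib]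
    calc |∑ κ', (∑' u', r ν y' κ' u' * X κ u κ' u' x z (Sum.inl κ₁) (Sum.inl κ₂)
            - r ν y' κ' u * ∑' u', X κ u κ' u' x z (Sum.inl κ₁) (Sum.inl κ₂))|
        ≤ ∑ κ', |∑' u', r ν y' κ' u' * X κ u κ' u' x z (Sum.inl κ₁) (Sum.inl κ₂)
            - r ν y' κ' u * ∑' u', X κ u κ' u' x z (Sum.inl κ₁) (Sum.inl κ₂)| := Finset.abs_sum_le_sum_abs _ _
      _ ≤ ∑ _κ' : Fin (d + 1), q₁ * 1 * (C * Real.exp (-δ * (l1 (x - u) + l1 (z - u)))) * (2 / (δ - κ₀) * Zl (d + 1) ((δ - κ₀) / 2)) :=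
          Finset.sum_le_sum fun κ' _ => hrem κ' x z κ₁ κ₂
      _ = _ := by rw [Finset.sum_const, Finset.card_univ, Fintype.card_fin, nsmul_eq_mul, mul_add, Real.exp_add]; ring
  -- summability of both `x`-integrands
  have hWb : ∀ z κ₁ κ₂ x, |vertexW r (X κ u) ν y' x z (Sum.inl κ₁) (Sum.inl κ₂)| ≤
      ((d + 1 : ℕ) * p₁ * C * Zl (d + 1) (δ - κ₀) * Real.exp (-δ * l1 (z - u))) * Real.exp (-δ * l1 (x - u)) :=
    fun z κ₁ κ₂ x => abs_W_le hX hκδ hp₁ hr₁ x z κ₁ κ₂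
  have hWs : ∀ z κ₁ κ₂, Summable fun x => vertexW r (X κ u) ν y' x z (Sum.inl κ₁) (Sum.inl κ₂) := fun z κ₁ κ₂ =>
    summable_of_abs_le_exp hδ u (hWb z κ₁ κ₂)
  have hFb : ∀ z κ₁ κ₂ x, |∑ κ', r ν y' κ' u * ∑' u', X κ u κ' u' x z (Sum.inl κ₁) (Sum.inl κ₂)| ≤
      ((d + 1 : ℕ) * (p₁ * (C * Zl (d + 1) δ)) * Real.exp (-δ * l1 (z - u))) * Real.exp (-δ * l1 (x - u)) := by
    intro z κ₁ κ₂ x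
    calc |∑ κ', r ν y' κ' u * ∑' u', X κ u κ' u' x z (Sum.inl κ₁) (Sum.inl κ₂)|
        ≤ ∑ κ', |r ν y' κ' u * ∑' u', X κ u κ' u' x z (Sum.inl κ₁) (Sum.inl κ₂)| := Finset.abs_sum_le_sum_abs _ _
      _ ≤ ∑ _κ' : Fin (d + 1), p₁ * (C * Zl (d + 1) δ * Real.exp (-δ * (l1 (x - u) + l1 (z - u)))) :=
          Finset.sum_le_sum fun κ' _ => by
            rw [abs_mul]
            exact mul_le_mul (abs_base_le (hr₁ κ')) (abs_tsum_slice_le hX hδ κ' x z κ₁ κ₂).2 (abs_nonneg _) hp₁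
      _ = _ := by rw [Finset.sum_const, Finset.card_univ, Fintype.card_fin, nsmul_eq_mul, mul_add, Real.exp_add]; ring
  have hFs : ∀ z κ₁ κ₂, Summable fun x => ∑ κ', r ν y' κ' u * ∑' u', X κ u κ' u' x z (Sum.inl κ₁) (Sum.inl κ₂) :=
    fun z κ₁ κ₂ => summable_of_abs_le_exp hδ u (hFb z κ₁ κ₂)
  -- per (z, κ₂): the κ₁-sum of `l₁(u)·Σ'_x D₁`
  set R : (Fin (d + 1) → ℤ) → Fin (d + 1) → ℝ := fun z κ₂ => ∑ κ₁, l α x' κ₁ u * ∑' x, D₁ x z κ₁ κ₂ with hR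
  have hRb : ∀ κ₂ z, |R z κ₂| ≤ ((d + 1 : ℕ) * (p₂ * (((d + 1 : ℕ) * (q₁ * 1 * C * (2 / (δ - κ₀) * Zl (d + 1) ((δ - κ₀) / 2))))
      * Zl (d + 1) δ))) * Real.exp (-δ * l1 (z - u)) := by
    intro κ₂ z
    calc |R z κ₂| ≤ ∑ κ₁, |l α x' κ₁ u * ∑' x, D₁ x z κ₁ κ₂| := Finset.abs_sum_le_sum_abs _ _
      _ ≤ ∑ _κ₁ : Fin (d + 1), p₂ * (((d + 1 : ℕ) * (q₁ * 1 * C * (2 / (δ - κ₀) * Zl (d + 1) ((δ - κ₀) / 2))) *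
          Real.exp (-δ * l1 (z - u))) * Zl (d + 1) δ) := Finset.sum_le_sum fun κ₁ _ => by
            rw [abs_mul]
            exact mul_le_mul (abs_base_le (hl₁ κ₁)) (abs_tsum_le_of_abs_le_exp hδ u (hD₁b z κ₁ κ₂)) (abs_nonneg _) hp₂
      _ = _ := by rw [Finset.sum_const, Finset.card_univ, Fintype.card_fin, nsmul_eq_mul]; ring
  -- the two `z`-integrands are summable and differ by `R z κ₂`
  have hIb : ∀ κ₂ z, |∑ κ₁, l α x' κ₁ u * ∑' x, vertexW r (X κ u) ν y' x z (Sum.inl κ₁) (Sum.inl κ₂)| ≤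
      ((d + 1 : ℕ) * (p₂ * (((d + 1 : ℕ) * p₁ * C * Zl (d + 1) (δ - κ₀)) * Zl (d + 1) δ))) * Real.exp (-δ * l1 (z - u)) := by
    intro κ₂ z
    calc |∑ κ₁, l α x' κ₁ u * ∑' x, vertexW r (X κ u) ν y' x z (Sum.inl κ₁) (Sum.inl κ₂)|
        ≤ ∑ κ₁, |l α x' κ₁ u * ∑' x, vertexW r (X κ u) ν y' x z (Sum.inl κ₁) (Sum.inl κ₂)| := Finset.abs_sum_le_sum_abs _ _
      _ ≤ ∑ _κ₁ : Fin (d + 1), p₂ * (((d + 1 : ℕ) * p₁ * C * Zl (d + 1) (δ - κ₀) * Real.exp (-δ * l1 (z - u))) * Zl (d + 1) δ) :=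
          Finset.sum_le_sum fun κ₁ _ => by
            rw [abs_mul]
            exact mul_le_mul (abs_base_le (hl₁ κ₁)) (abs_tsum_le_of_abs_le_exp hδ u (hWb z κ₁ κ₂)) (abs_nonneg _) hp₂
      _ = _ := by rw [Finset.sum_const, Finset.card_univ, Fintype.card_fin, nsmul_eq_mul]; ring
  have hJb : ∀ κ₂ z, |∑ κ₁, l α x' κ₁ u * ∑' x, ∑ κ', r ν y' κ' u * ∑' u', X κ u κ' u' x z (Sum.inl κ₁) (Sum.inl κ₂)| ≤
      ((d + 1 : ℕ) * (p₂ * (((d + 1 : ℕ) * (p₁ * (C * Zl (d + 1) δ))) * Zl (d + 1) δ))) * Real.exp (-δ * l1 (z - u)) := by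
    intro κ₂ z
    calc |∑ κ₁, l α x' κ₁ u * ∑' x, ∑ κ', r ν y' κ' u * ∑' u', X κ u κ' u' x z (Sum.inl κ₁) (Sum.inl κ₂)|
        ≤ ∑ κ₁, |l α x' κ₁ u * ∑' x, ∑ κ', r ν y' κ' u * ∑' u', X κ u κ' u' x z (Sum.inl κ₁) (Sum.inl κ₂)| :=
          Finset.abs_sum_le_sum_abs _ _
      _ ≤ ∑ _κ₁ : Fin (d + 1), p₂ * ((((d + 1 : ℕ) * (p₁ * (C * Zl (d + 1) δ))) * Real.exp (-δ * l1 (z - u))) * Zl (d + 1) δ) :=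
          Finset.sum_le_sum fun κ₁ _ => by
            rw [abs_mul]
            exact mul_le_mul (abs_base_le (hl₁ κ₁)) (abs_tsum_le_of_abs_le_exp hδ u (hFb z κ₁ κ₂)) (abs_nonneg _) hp₂
      _ = _ := by rw [Finset.sum_const, Finset.card_univ, Fintype.card_fin, nsmul_eq_mul]; ring
  have hIs : ∀ κ₂, Summable fun z => ∑ κ₁, l α x' κ₁ u * ∑' x, vertexW r (X κ u) ν y' x z (Sum.inl κ₁) (Sum.inl κ₂) :=
    fun κ₂ => summable_of_abs_le_exp hδ u (hIb κ₂)
  have hJs : ∀ κ₂, Summable fun z => ∑ κ₁, l α x' κ₁ u * ∑' x, ∑ κ', r ν y' κ' u * ∑' u', X κ u κ' u' x z (Sum.inl κ₁) (Sum.inl κ₂) :=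
    fun κ₂ => summable_of_abs_le_exp hδ u (hJb κ₂)
  have hdiff : ∀ κ₂, (∑' z, ∑ κ₁, l α x' κ₁ u * ∑' x, vertexW r (X κ u) ν y' x z (Sum.inl κ₁) (Sum.inl κ₂))
      - (∑' z, ∑ κ₁, l α x' κ₁ u * ∑' x, ∑ κ', r ν y' κ' u * ∑' u', X κ u κ' u' x z (Sum.inl κ₁) (Sum.inl κ₂))
      = ∑' z, R z κ₂ := by
    intro κ₂
    rw [← (hIs κ₂).tsum_sub (hJs κ₂)]
    refine tsum_congr fun z => ?_
    rw [hR]; dsimp only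
    rw [← Finset.sum_sub_distrib]
    refine Finset.sum_congr rfl fun κ₁ _ => ?_
    rw [← mul_sub, ← (hWs z κ₁ κ₂).tsum_sub (hFs z κ₁ κ₂)]
  rw [← Finset.sum_sub_distrib]
  calc |∑ κ₂, (r β z' κ₂ u * ∑' z, ∑ κ₁, l α x' κ₁ u * ∑' x, vertexW r (X κ u) ν y' x z (Sum.inl κ₁) (Sum.inl κ₂)
          - r β z' κ₂ u * ∑' z, ∑ κ₁, l α x' κ₁ u * ∑' x, ∑ κ', r ν y' κ' u * ∑' u', X κ u κ' u' x z (Sum.inl κ₁) (Sum.inl κ₂))|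
      ≤ ∑ κ₂, |r β z' κ₂ u * ∑' z, ∑ κ₁, l α x' κ₁ u * ∑' x, vertexW r (X κ u) ν y' x z (Sum.inl κ₁) (Sum.inl κ₂)
          - r β z' κ₂ u * ∑' z, ∑ κ₁, l α x' κ₁ u * ∑' x, ∑ κ', r ν y' κ' u * ∑' u', X κ u κ' u' x z (Sum.inl κ₁) (Sum.inl κ₂)| :=
        Finset.abs_sum_le_sum_abs _ _
    _ ≤ ∑ _κ₂ : Fin (d + 1), p₃ * ((((d + 1 : ℕ) * (p₂ * (((d + 1 : ℕ) * (q₁ * 1 * C * (2 / (δ - κ₀) * Zl (d + 1) ((δ - κ₀) / 2))))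
          * Zl (d + 1) δ))) * Zl (d + 1) δ)) := Finset.sum_le_sum fun κ₂ _ => by
        rw [← mul_sub, abs_mul, hdiff κ₂]
        exact mul_le_mul (abs_base_le (hr₂ κ₂)) (abs_tsum_le_of_abs_le_exp hδ u (hRb κ₂)) (abs_nonneg _) hp₃
    _ = _ := by rw [Finset.sum_const, Finset.card_univ, Fintype.card_fin, nsmul_eq_mul]

end Steps

/-! ## §3 The frozen term is the slice charge -/

section Frozen
include hX hδ

/-- [folklore] **THE FULLY FROZEN TERM IS THE SLICE CHARGE**: pulling the three frozen legs out of the nested sums and re-ordering the table's own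
triple sum (`Push4Slices.tsum_zxu_eq_sliceSum`),
`Σ_{κ₂} r₂(u)·Σ'_z Σ_{κ₁} l₁(u)·Σ'_x Σ_{κ′} r₁(u)·Σ'_{u′} X… = Σ_{κ₂} Σ_{κ₁} Σ_{κ′} r β z′ κ₂ u·(l α x′ κ₁ u·(r ν y′ κ′ u·sliceSum X κ u κ′ κ₁ κ₂))`. -/
theorem frozen_eq_sum_sliceSum :
    (∑ κ₂, r β z' κ₂ u * ∑' z : Fin (d + 1) → ℤ, ∑ κ₁, l α x' κ₁ u *
        ∑' x : Fin (d + 1) → ℤ, ∑ κ', r ν y' κ' u * ∑' u' : Fin (d + 1) → ℤ, X κ u κ' u' x z (Sum.inl κ₁) (Sum.inl κ₂))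
      = ∑ κ₂, ∑ κ₁, ∑ κ', r β z' κ₂ u * (l α x' κ₁ u * (r ν y' κ' u * sliceSum X κ u κ' κ₁ κ₂)) := by
  refine Finset.sum_congr rfl fun κ₂ _ => ?_
  -- innermost: `Σ'_x Σ_{κ'} c·F = Σ_{κ'} c·Σ'_x F`
  have hFx : ∀ z κ₁ κ', Summable fun x => ∑' u', X κ u κ' u' x z (Sum.inl κ₁) (Sum.inl κ₂) := fun z κ₁ κ' =>
    summable_of_abs_le_exp hδ u (B := C * Zl (d + 1) δ * Real.exp (-δ * l1 (z - u)))
      (fun x => ((abs_tsum_slice_le hX hδ κ' x z κ₁ κ₂).2).trans (le_of_eq (by rw [mul_add, Real.exp_add]; ring)))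
  have hx_swap : ∀ z κ₁, (∑' x, ∑ κ', r ν y' κ' u * ∑' u', X κ u κ' u' x z (Sum.inl κ₁) (Sum.inl κ₂))
      = ∑ κ', r ν y' κ' u * ∑' x, ∑' u', X κ u κ' u' x z (Sum.inl κ₁) (Sum.inl κ₂) := by
    intro z κ₁
    rw [Summable.tsum_finsetSum (fun κ' _ => (hFx z κ₁ κ').mul_left _)]
    exact Finset.sum_congr rfl fun κ' _ => tsum_mul_left
  have hHz : ∀ κ₁ κ', Summable fun z => ∑' x, ∑' u', X κ u κ' u' x z (Sum.inl κ₁) (Sum.inl κ₂) := by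
    intro κ₁ κ'
    refine summable_of_abs_le_exp hδ u (B := C * Zl (d + 1) δ * Zl (d + 1) δ) (fun z => ?_)
    have hb := abs_tsum_le_of_abs_le_exp hδ u (B := C * Zl (d + 1) δ * Real.exp (-δ * l1 (z - u)))
      (f := fun x => ∑' u', X κ u κ' u' x z (Sum.inl κ₁) (Sum.inl κ₂))
      (fun x => ((abs_tsum_slice_le hX hδ κ' x z κ₁ κ₂).2).trans (le_of_eq (by rw [mul_add, Real.exp_add]; ring)))
    refine hb.trans (le_of_eq ?_); ring
  simp_rw [hx_swap]
  have hz_swap : (∑' z, ∑ κ₁, l α x' κ₁ u * ∑ κ', r ν y' κ' u * ∑' x, ∑' u', X κ u κ' u' x z (Sum.inl κ₁) (Sum.inl κ₂))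
      = ∑ κ₁, ∑ κ', l α x' κ₁ u * (r ν y' κ' u * ∑' z, ∑' x, ∑' u', X κ u κ' u' x z (Sum.inl κ₁) (Sum.inl κ₂)) := by
    have hs1 : ∀ κ₁ ∈ (Finset.univ : Finset (Fin (d + 1))), Summable fun z =>
        l α x' κ₁ u * ∑ κ', r ν y' κ' u * ∑' x, ∑' u', X κ u κ' u' x z (Sum.inl κ₁) (Sum.inl κ₂) :=
      fun κ₁ _ => (summable_sum fun κ' _ => (hHz κ₁ κ').mul_left (r ν y' κ' u)).mul_left _
    rw [Summable.tsum_finsetSum hs1]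
    refine Finset.sum_congr rfl fun κ₁ _ => ?_
    rw [tsum_mul_left, Summable.tsum_finsetSum (fun κ' _ => (hHz κ₁ κ').mul_left (r ν y' κ' u)), Finset.mul_sum]
    refine Finset.sum_congr rfl fun κ' _ => ?_
    rw [tsum_mul_left]
  rw [hz_swap, Finset.mul_sum]
  refine Finset.sum_congr rfl fun κ₁ _ => ?_
  rw [Finset.mul_sum]
  refine Finset.sum_congr rfl fun κ' _ => ?_
  rw [tsum_zxu_eq_sliceSum hX hδ κ u κ' κ₁ κ₂]

end Frozen

/-! ## §4 The packaged statement -/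

include hX hδ hκ0 hκδ hp₁ hq₁ hp₂ hq₂ hp₃ hq₃ hr₁ hr₁' hl₁ hl₁' hr₂ hr₂' in
/-- NOT IN PRINT; OUR PROOF.  **FREEZING THE SLICE PUSH AT THE FIRST TABLE BOND — ONE TAYLOR ORDER**: with the three inner legs given by SUP and LIPSCHITZ
allowances relative to the base point `u` (`|leg v| ≤ p·e^{κ₀|v−u|₁}`, `|leg v − leg u| ≤ q·|v−u|₁·e^{κ₀|v−u|₁}`, `0 ≤ κ₀ < δ`) and `LocStencil₂ X C δ`,
`|push₃ l r (X κ u) ν y′ x′ z′ (inl α) (inl β) − Σ_{κ₂ κ₁ κ′} r β z′ κ₂ u·(l α x′ κ₁ u·(r ν y′ κ′ u·sliceSum X κ u κ′ κ₁ κ₂))|`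
`≤ (d+1)³·C·M₁·(q₃·p₁·p₂·Zl₁² + p₃·q₂·p₁·Zl₁·Zl δ + p₃·p₂·q₁·(Zl δ)²)`, `Zl₁ = Zl(δ−κ₀)`, `M₁ = (2/(δ−κ₀))·Zl((δ−κ₀)/2)` — every remainder
carries exactly ONE Lipschitz allowance `q` (the gain `L⁻¹` of (T-irr), once `q = A′·L^{−(d+3)}·envelope`). -/
theorem abs_push₃_sub_frozen_le :
    |push₃ l r (X κ u) ν y' x' z' (Sum.inl α) (Sum.inl β)
        - ∑ κ₂, ∑ κ₁, ∑ κ', r β z' κ₂ u * (l α x' κ₁ u * (r ν y' κ' u * sliceSum X κ u κ' κ₁ κ₂))|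
      ≤ ((d + 1 : ℕ) : ℝ) ^ 3 * C * (2 / (δ - κ₀) * Zl (d + 1) ((δ - κ₀) / 2)) *
          (q₃ * p₁ * p₂ * Zl (d + 1) (δ - κ₀) * Zl (d + 1) (δ - κ₀)
            + p₃ * q₂ * p₁ * Zl (d + 1) (δ - κ₀) * Zl (d + 1) δ + p₃ * p₂ * q₁ * Zl (d + 1) δ * Zl (d + 1) δ) := by
  have hC := stepC hX hκ0 hκδ hp₁ hp₂ hp₃ hq₃ hr₁ hl₁ hr₂ hr₂' (κ := κ) (ν := ν) (α := α) (x' := x')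
  have hB := stepB hX hδ hκ0 hκδ hp₁ hp₂ hq₂ hp₃ hr₁ hl₁ hl₁' hr₂ (κ := κ)
  have hA := stepA hX hδ hκ0 hκδ hp₁ hq₁ hp₂ hp₃ hr₁ hr₁' hl₁ hr₂ (κ := κ)
  rw [← frozen_eq_sum_sliceSum hX hδ]
  refine (abs_sub_le_of_three hC hB hA).trans (le_of_eq ?_)
  push_cast
  ring

end Slice

end Summit.QuantumFields.BalabanUV.Beta.GAN24.Push4Frozen

end
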